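import Summits.Parity.GeneralizedHardyLittlewood.Theorems.PrimeLevelFamEdgeMomentsBeyondDiagonalDiagRemMomentsParam
import Summits.Parity.GeneralizedHardyLittlewood.Theorems.PrimeLevelFamEdgeMomentsBeyondDiagonalDiagRemRademacherEight
import HarnessLib

/-!
# Route `PrimeLevelFamEdge`, crux K_A `MomentsBeyondDiagonal` (stmt-Parity-20007), line «petersson_layers» v4, stub `stub_diag`:
# **the nine family envelopes `h0 … hDD` of the order-`(4,4)` remainder weight, discharged GENERICALLY** (the analytic core of the
# inner estimate B4 of (R₄₄): hypotheses of `…DiagRemFourFourMonomials.abs_monomial_weight_le₄₄` / `…FourFourProfile.abs_profile_weight_le₄₄`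
# at `a = a_n`, `P_j(k) = Σ_{p∣k}logʲp`, for abstract kernels `R_ab`)

For any 25 kernels `R_ab` (`a, b ≤ 4`) sharing the two-sequence Abel estimate (constant `C₀`, envelope exponent `N`) and, for the 15 with
`a + b ≤ 4`, the pointwise bounds `C₀√y` / `C₀(1+log y)^M` (this is `…DiagRemFourFourKernelsAll.twoSeq_twentyfive₄₄` with `N = 10`, `M = 5`),
the nine families of `abs_monomial_weight_le₄₄` hold with the UNIFORM envelopes
`Ψ_e = C₀·K·D(n)²·(1+log Y)^e·(√(2αK₁Y) + x^N/(1+log K₁)^A)`, `e = 2, 4, 6, 8, 10, 4, 6, 8, 6` (`h0, h2, h4, h6, h8, hB, hBD, hBS, hDD`),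
`x = 1+|log 2αY²|`, one absolute `K` for all `n, Y, α, K₁` — every one-sided family by `…MomentsParam.abs_onesided_moments_le_pow_of`
(`s = 0, 2, 4, 6, 8`), every both-sided one by `abs_bothsided_moments_le_pow_of` (`(2,2), (2,4), (2,6), (4,4)`), the decorations bridged by
the Rademacher identities (`…Rademacher`, `…RademacherEight`) and the tails by «DRTAIL» (`…MomentTailBoundPow`).

* `onesided_env_le`, `bothsided_env_le` — collecting the generic bounds into the uniform envelope;
* `remainder_families₄₄` — **the nine family bounds** (what is left for (R₄₄): the `Q`-coordinate bridge to the landed kernels, the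
  envelope arithmetic against `(6561Λ⁸, 1694Λ⁶, 94Λ⁴, 3Λ², 1, 279Λ⁴, 30Λ², 1, 1)`, and the outer `(c,g)` sum — templating).

Def-free; theorems only. Helper `--supports stmt-Parity-20007`; closes nothing; K_A, K_B and the Parity summit are NOT proved;
nothing about Landau–Siegel zeros.

## References
* E. Kowalski, P. Michel, J. VanderKam, J. reine angew. Math. 526 (2000), (23)–(28) and Prop. 5.1 p. 18.
  [cite: KowalskiMichelVanderKam2000, (23)–(28) and Prop. 5.1 — derivation (order-(4,4) remainder, family envelopes)]
-/

noncomputable section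

open Real Finset

namespace Summit.Parity.GeneralizedHardyLittlewood.Theorems.MomentsBeyondDiagonal.DiagCorner

open Literature.NumberTheory.LFunctions.KMV2000.MollifierMainTerm (W)
open Summit.Parity.GeneralizedHardyLittlewood.Theorems.BeyondDiagonalBeatsQuarter.KernelFormXSq
  (copTauW divWeight divWeight_nonneg one_le_divWeight)
open Summit.Parity.GeneralizedHardyLittlewood.Theorems.BeyondDiagonalBeatsQuarter.Corner

/-- Collecting the one-sided generic bound into the uniform envelope: `6C_sD L²sq + 18L^{s+2}C_aD X ≤ K D² L^{s+2}(sq + X)` when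
`6C_s + 18C_a ≤ K`, `D, L ≥ 1`. [folklore] -/
theorem onesided_env_le {C₀ Cs Ca D L sq xN KA K : ℝ} (s : ℕ) (hC₀ : 0 ≤ C₀) (hCs : 0 ≤ Cs) (hCa : 0 ≤ Ca)
    (hD : 1 ≤ D) (hL : 1 ≤ L) (hsq : 0 ≤ sq) (hxN : 0 ≤ xN) (hKA : 0 < KA) (hK : 6 * Cs + 18 * Ca ≤ K) :
    C₀ * (6 * (Cs * D) * L ^ 2 * sq + 18 * L ^ (s + 2) * (Ca * D) * xN / KA) ≤ C₀ * (K * D ^ 2 * L ^ (s + 2) * (sq + xN / KA)) := by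
  refine mul_le_mul_of_nonneg_left ?_ hC₀
  set X : ℝ := xN / KA with hXdef
  have hX : 0 ≤ X := by positivity
  rw [show 18 * L ^ (s + 2) * (Ca * D) * xN / KA = 18 * L ^ (s + 2) * (Ca * D) * X by rw [hXdef]; ring]
  have hD2 : D ≤ D ^ 2 := by nlinarith
  have hL2 : L ^ 2 ≤ L ^ (s + 2) := pow_le_pow_right₀ hL (by omega)
  have hLp : 0 ≤ L ^ (s + 2) := by positivity
  have h1 : 6 * (Cs * D) * L ^ 2 * sq ≤ 6 * Cs * (D ^ 2 * L ^ (s + 2) * sq) := by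
    have : D * L ^ 2 ≤ D ^ 2 * L ^ (s + 2) := mul_le_mul hD2 hL2 (by positivity) (by positivity)
    nlinarith [mul_nonneg (mul_nonneg hCs hsq) (sub_nonneg.2 this)]
  have h2 : 18 * L ^ (s + 2) * (Ca * D) * X ≤ 18 * Ca * (D ^ 2 * L ^ (s + 2) * X) := by
    nlinarith [mul_nonneg (mul_nonneg hCa hX) (mul_nonneg (sub_nonneg.2 hD2) hLp)]
  have h3 : 6 * Cs * (D ^ 2 * L ^ (s + 2) * sq) + 18 * Ca * (D ^ 2 * L ^ (s + 2) * X) ≤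
      K * D ^ 2 * L ^ (s + 2) * (sq + X) := by
    have hA : 0 ≤ D ^ 2 * L ^ (s + 2) * sq := by positivity
    have hB : 0 ≤ D ^ 2 * L ^ (s + 2) * X := by positivity
    nlinarith [mul_nonneg (by linarith : 0 ≤ K - 6 * Cs) hA, mul_nonneg (by linarith : 0 ≤ K - 18 * Ca) hB]
  linarith

/-- Collecting the both-sided generic bound into the uniform envelope (`r + 2, s + 2 ≤ e`, `D, L ≥ 1`,
`6C₂ + 3C₁ + 10C₁C₂ ≤ K`, `18C₁ + 19C₁C₂ ≤ K`). [folklore] -/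
theorem bothsided_env_le {C₀ C₁ C₂ D L sq xN KA K : ℝ} (r s e : ℕ) (hC₀ : 0 ≤ C₀) (hC₁ : 0 ≤ C₁) (hC₂ : 0 ≤ C₂)
    (hD : 1 ≤ D) (hL : 1 ≤ L) (hsq : 0 ≤ sq) (hxN : 0 ≤ xN) (hKA : 0 < KA) (hre : r + 2 ≤ e) (hse : s + 2 ≤ e)
    (hK1 : 6 * C₂ + 3 * C₁ + 10 * C₁ * C₂ ≤ K) (hK2 : 18 * C₁ + 19 * C₁ * C₂ ≤ K) :
    C₀ * ((6 * (C₂ * D) * (L ^ (r + 2) + C₁ * D) + 3 * (C₁ * D) * (L ^ (s + 2) + C₂ * D) + (C₁ * D) * (C₂ * D)) * sq +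
        (18 * L ^ (s + 2) * (C₁ * D) + 19 * ((C₁ * D) * (C₂ * D))) * xN / KA) ≤ C₀ * (K * D ^ 2 * L ^ e * (sq + xN / KA)) := by
  refine mul_le_mul_of_nonneg_left ?_ hC₀
  set X : ℝ := xN / KA with hXdef
  have hX : 0 ≤ X := by positivity
  rw [show (18 * L ^ (s + 2) * (C₁ * D) + 19 * ((C₁ * D) * (C₂ * D))) * xN / KA =
      (18 * L ^ (s + 2) * (C₁ * D) + 19 * ((C₁ * D) * (C₂ * D))) * X by rw [hXdef]; ring]
  have hD2 : D ≤ D ^ 2 := by nlinarith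
  have hD0 : 0 ≤ D := by linarith
  have hLe1 : 1 ≤ L ^ e := one_le_pow₀ hL
  have hLr : L ^ (r + 2) ≤ L ^ e := pow_le_pow_right₀ hL hre
  have hLs : L ^ (s + 2) ≤ L ^ e := pow_le_pow_right₀ hL hse
  have hLe0 : 0 ≤ L ^ e := by positivity
  set G : ℝ := D ^ 2 * L ^ e with hG
  have hG0 : 0 ≤ G := by positivity
  -- each piece ≤ (coefficient) · G
  have p1 : C₂ * D * L ^ (r + 2) ≤ C₂ * G := by
    have : D * L ^ (r + 2) ≤ D ^ 2 * L ^ e := mul_le_mul hD2 hLr (by positivity) (by positivity)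
    nlinarith
  have p2 : C₂ * D * (C₁ * D) ≤ C₁ * C₂ * G := by
    have : D * D ≤ G := by rw [hG, ← pow_two]; exact le_mul_of_one_le_right (by positivity) hLe1
    nlinarith [mul_nonneg hC₁ hC₂]
  have p3 : C₁ * D * L ^ (s + 2) ≤ C₁ * G := by
    have : D * L ^ (s + 2) ≤ D ^ 2 * L ^ e := mul_le_mul hD2 hLs (by positivity) (by positivity)
    nlinarith
  have p4 : C₁ * D * (C₂ * D) ≤ C₁ * C₂ * G := by
    have : D * D ≤ G := by rw [hG, ← pow_two]; exact le_mul_of_one_le_right (by positivity) hLe1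
    nlinarith [mul_nonneg hC₁ hC₂]
  have hsqc : 6 * (C₂ * D) * (L ^ (r + 2) + C₁ * D) + 3 * (C₁ * D) * (L ^ (s + 2) + C₂ * D) + (C₁ * D) * (C₂ * D) ≤ K * G := by
    have : 6 * (C₂ * D) * (L ^ (r + 2) + C₁ * D) + 3 * (C₁ * D) * (L ^ (s + 2) + C₂ * D) + (C₁ * D) * (C₂ * D) ≤
        (6 * C₂ + 3 * C₁ + 10 * C₁ * C₂) * G := by nlinarith
    exact this.trans (mul_le_mul_of_nonneg_right hK1 hG0)
  have hXc : 18 * L ^ (s + 2) * (C₁ * D) + 19 * ((C₁ * D) * (C₂ * D)) ≤ K * G := by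
    have : 18 * L ^ (s + 2) * (C₁ * D) + 19 * ((C₁ * D) * (C₂ * D)) ≤ (18 * C₁ + 19 * C₁ * C₂) * G := by nlinarith
    exact this.trans (mul_le_mul_of_nonneg_right hK2 hG0)
  calc _ ≤ K * G * sq + K * G * X := add_le_add (mul_le_mul_of_nonneg_right hsqc hsq) (mul_le_mul_of_nonneg_right hXc hX)
    _ = K * D ^ 2 * L ^ e * (sq + X) := by rw [hG]; ring

set_option maxHeartbeats 6400000 in
/-- **The nine family envelopes of the order-`(4,4)` remainder weight, generically** (see the module docstring).
[cite: KowalskiMichelVanderKam2000, (23)–(28) and Prop. 5.1 — derivation (order-(4,4) remainder, family envelopes)] -/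
theorem remainder_families₄₄ (A : ℕ) {N M : ℕ} (hMN : M ≤ N) {C₀ : ℝ} (hC₀ : 0 ≤ C₀)
    {R₀₀ R₀₁ R₀₂ R₀₃ R₀₄ R₁₀ R₁₁ R₁₂ R₁₃ R₁₄ R₂₀ R₂₁ R₂₂ R₂₃ R₂₄ R₃₀ R₃₁ R₃₂ R₃₃ R₃₄ R₄₀ R₄₁ R₄₂ R₄₃ R₄₄ : ℝ → ℝ}
    (hall : ∀ R : ℝ → ℝ, (R = R₀₀ ∨ R = R₀₁ ∨ R = R₀₂ ∨ R = R₀₃ ∨ R = R₀₄ ∨ R = R₁₀ ∨ R = R₁₁ ∨ R = R₁₂ ∨ R = R₁₃ ∨ R = R₁₄ ∨ R = R₂₀ ∨ R = R₂₁ ∨ R = R₂₂ ∨ R = R₂₃ ∨ R = R₂₄ ∨ R = R₃₀ ∨ R = R₃₁ ∨ R = R₃₂ ∨ R = R₃₃ ∨ R = R₃₄ ∨ R = R₄₀ ∨ R = R₄₁ ∨ R = R₄₂ ∨ R = R₄₃ ∨ R = R₄₄) →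
      ∀ (a₁ a₂ : ℕ → ℝ) (Y α B η : ℝ) (K₁ i j : ℕ), 1 ≤ Y → 0 < α → 1 ≤ i → 1 ≤ j →
        (∀ e : ℕ, e ≤ ⌊Y⌋₊ → |∑ k ∈ Icc 1 e, a₂ k| ≤ B) → (∀ e : ℕ, K₁ ≤ e → |∑ k ∈ Icc 1 e, a₁ k| ≤ η) →
        2 * α * K₁ * Y ≤ 1 →
      |∑ k₁ ∈ Icc 1 ⌊Y⌋₊, ∑ k₂ ∈ Icc 1 ⌊Y⌋₊,
          a₁ k₁ * a₂ k₂ * ellp Y k₁ ^ i * ellp Y k₂ ^ j * R (α * k₁ * k₂)| ≤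
        (∑ k ∈ Icc 1 ⌊Y⌋₊, |a₁ k| * ellp Y k ^ i) * (B * (Real.log Y ^ j * (3 * C₀ * Real.sqrt (2 * α * K₁ * Y)))) +
          (∑ k ∈ Icc 1 ⌊Y⌋₊, |a₂ k| * ellp Y k ^ j) *
            ((2 * η) * (Real.log Y ^ i * (9 * C₀ * (1 + |Real.log (2 * α * Y ^ 2)|) ^ N))))
    (hpw : ∀ R : ℝ → ℝ, (R = R₀₀ ∨ R = R₀₁ ∨ R = R₀₂ ∨ R = R₀₃ ∨ R = R₀₄ ∨ R = R₁₀ ∨ R = R₁₁ ∨ R = R₁₂ ∨ R = R₁₃ ∨ R = R₂₀ ∨ R = R₂₁ ∨ R = R₂₂ ∨ R = R₃₀ ∨ R = R₃₁ ∨ R = R₄₀) →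
      (∀ y : ℝ, 0 < y → y ≤ 1 → |R y| ≤ C₀ * Real.sqrt y) ∧ (∀ y : ℝ, 1 ≤ y → |R y| ≤ C₀ * (1 + Real.log y) ^ M)) :
    ∃ K : ℝ, 0 ≤ K ∧ ∀ n : ℕ, n ≠ 0 → ∀ (Y α : ℝ) (K₁ : ℕ), 1 ≤ Y → 0 < α → 2 * α * K₁ * Y ≤ 1 →
      (∀ R : ℝ → ℝ, (R = R₀₀ ∨ R = R₀₁ ∨ R = R₀₂ ∨ R = R₀₃ ∨ R = R₀₄ ∨ R = R₁₀ ∨ R = R₁₁ ∨ R = R₁₂ ∨ R = R₁₃ ∨ R = R₁₄ ∨ R = R₂₀ ∨ R = R₂₁ ∨ R = R₂₂ ∨ R = R₂₃ ∨ R = R₂₄ ∨ R = R₃₀ ∨ R = R₃₁ ∨ R = R₃₂ ∨ R = R₃₃ ∨ R = R₃₄ ∨ R = R₄₀ ∨ R = R₄₁ ∨ R = R₄₂ ∨ R = R₄₃ ∨ R = R₄₄) →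
      ∀ i j : ℕ, 1 ≤ i → 1 ≤ j →
      |∑ k₁ ∈ Icc 1 ⌊Y⌋₊, ∑ k₂ ∈ Icc 1 ⌊Y⌋₊,
          copTauW n k₁ * copTauW n k₂ * ellp Y k₁ ^ i * ellp Y k₂ ^ j * R (α * k₁ * k₂)| ≤ Real.log Y ^ (i + j) *
          (C₀ * (K * divWeight n ^ 2 * (1 + Real.log Y) ^ 2 * (Real.sqrt (2 * α * K₁ * Y) + (1 + |Real.log (2 * α * Y ^ 2)|) ^ N / (1 + Real.log K₁) ^ A)))) ∧
      (∀ R : ℝ → ℝ, (R = R₀₀ ∨ R = R₀₁ ∨ R = R₀₂ ∨ R = R₀₃ ∨ R = R₀₄ ∨ R = R₁₀ ∨ R = R₁₁ ∨ R = R₁₂ ∨ R = R₁₄ ∨ R = R₂₀ ∨ R = R₂₁ ∨ R = R₂₂ ∨ R = R₂₃ ∨ R = R₂₄ ∨ R = R₃₀ ∨ R = R₃₂ ∨ R = R₃₃ ∨ R = R₄₀ ∨ R = R₄₁ ∨ R = R₄₂) →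
      ∀ i j : ℕ, 1 ≤ i → 1 ≤ j →
      |∑ k₁ ∈ Icc 1 ⌊Y⌋₊, ∑ k₂ ∈ Icc 1 ⌊Y⌋₊,
          copTauW n k₁ * (copTauW n k₂ * (∑ p ∈ k₂.primeFactors, Real.log p ^ 2)) * ellp Y k₁ ^ i * ellp Y k₂ ^ j * R (α * k₁ * k₂)| ≤ Real.log Y ^ (i + j) *
          (C₀ * (K * divWeight n ^ 2 * (1 + Real.log Y) ^ 4 * (Real.sqrt (2 * α * K₁ * Y) + (1 + |Real.log (2 * α * Y ^ 2)|) ^ N / (1 + Real.log K₁) ^ A)))) ∧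
      (∀ R : ℝ → ℝ, (R = R₀₀ ∨ R = R₀₁ ∨ R = R₀₂ ∨ R = R₀₃ ∨ R = R₀₄ ∨ R = R₁₀ ∨ R = R₁₁ ∨ R = R₁₂ ∨ R = R₁₃ ∨ R = R₂₀ ∨ R = R₂₁ ∨ R = R₂₂ ∨ R = R₃₀ ∨ R = R₃₁ ∨ R = R₄₀) →
      ∀ i j : ℕ, 1 ≤ i → 1 ≤ j →
      |∑ k₁ ∈ Icc 1 ⌊Y⌋₊, ∑ k₂ ∈ Icc 1 ⌊Y⌋₊,
          copTauW n k₁ * (copTauW n k₂ * (3 * (∑ p ∈ k₂.primeFactors, Real.log p ^ 2) ^ 2 - 2 * (∑ p ∈ k₂.primeFactors, Real.log p ^ 4))) * ellp Y k₁ ^ i * ellp Y k₂ ^ j * R (α * k₁ * k₂)| ≤ Real.log Y ^ (i + j) *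
          (C₀ * (K * divWeight n ^ 2 * (1 + Real.log Y) ^ 6 * (Real.sqrt (2 * α * K₁ * Y) + (1 + |Real.log (2 * α * Y ^ 2)|) ^ N / (1 + Real.log K₁) ^ A)))) ∧
      (∀ R : ℝ → ℝ, (R = R₀₀ ∨ R = R₀₁ ∨ R = R₀₂ ∨ R = R₁₀ ∨ R = R₁₁ ∨ R = R₂₀) →
      ∀ i j : ℕ, 1 ≤ i → 1 ≤ j →
      |∑ k₁ ∈ Icc 1 ⌊Y⌋₊, ∑ k₂ ∈ Icc 1 ⌊Y⌋₊,
          copTauW n k₁ * (copTauW n k₂ * (15 * (∑ p ∈ k₂.primeFactors, Real.log p ^ 2) ^ 3 - 30 * (∑ p ∈ k₂.primeFactors, Real.log p ^ 2) * (∑ p ∈ k₂.primeFactors, Real.log p ^ 4) + 16 * (∑ p ∈ k₂.primeFactors, Real.log p ^ 6))) * ellp Y k₁ ^ i * ellp Y k₂ ^ j * R (α * k₁ * k₂)| ≤ Real.log Y ^ (i + j) *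
          (C₀ * (K * divWeight n ^ 2 * (1 + Real.log Y) ^ 8 * (Real.sqrt (2 * α * K₁ * Y) + (1 + |Real.log (2 * α * Y ^ 2)|) ^ N / (1 + Real.log K₁) ^ A)))) ∧
      (∀ i j : ℕ, 1 ≤ i → 1 ≤ j →
      |∑ k₁ ∈ Icc 1 ⌊Y⌋₊, ∑ k₂ ∈ Icc 1 ⌊Y⌋₊,
          copTauW n k₁ * (copTauW n k₂ * (105 * (∑ p ∈ k₂.primeFactors, Real.log p ^ 2) ^ 4 - 420 * (∑ p ∈ k₂.primeFactors, Real.log p ^ 2) ^ 2 * (∑ p ∈ k₂.primeFactors, Real.log p ^ 4) + 448 * (∑ p ∈ k₂.primeFactors, Real.log p ^ 2) * (∑ p ∈ k₂.primeFactors, Real.log p ^ 6) + 140 * (∑ p ∈ k₂.primeFactors, Real.log p ^ 4) ^ 2 - 272 * (∑ p ∈ k₂.primeFactors, Real.log p ^ 8))) * ellp Y k₁ ^ i * ellp Y k₂ ^ j * R₀₀ (α * k₁ * k₂)| ≤ Real.log Y ^ (i + j) *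
          (C₀ * (K * divWeight n ^ 2 * (1 + Real.log Y) ^ 10 * (Real.sqrt (2 * α * K₁ * Y) + (1 + |Real.log (2 * α * Y ^ 2)|) ^ N / (1 + Real.log K₁) ^ A)))) ∧
      (∀ R : ℝ → ℝ, (R = R₀₀ ∨ R = R₀₁ ∨ R = R₀₂ ∨ R = R₀₃ ∨ R = R₀₄ ∨ R = R₁₀ ∨ R = R₁₁ ∨ R = R₁₂ ∨ R = R₁₃ ∨ R = R₂₀ ∨ R = R₂₁ ∨ R = R₂₂ ∨ R = R₃₀ ∨ R = R₃₁ ∨ R = R₄₀) →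
      ∀ i j : ℕ, 1 ≤ i → 1 ≤ j →
      |∑ k₁ ∈ Icc 1 ⌊Y⌋₊, ∑ k₂ ∈ Icc 1 ⌊Y⌋₊,
          (copTauW n k₁ * (∑ p ∈ k₁.primeFactors, Real.log p ^ 2)) * (copTauW n k₂ * (∑ p ∈ k₂.primeFactors, Real.log p ^ 2)) * ellp Y k₁ ^ i * ellp Y k₂ ^ j * R (α * k₁ * k₂)| ≤ Real.log Y ^ (i + j) *
          (C₀ * (K * divWeight n ^ 2 * (1 + Real.log Y) ^ 4 * (Real.sqrt (2 * α * K₁ * Y) + (1 + |Real.log (2 * α * Y ^ 2)|) ^ N / (1 + Real.log K₁) ^ A)))) ∧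
      (∀ R : ℝ → ℝ, (R = R₀₀ ∨ R = R₀₁ ∨ R = R₀₂ ∨ R = R₁₀ ∨ R = R₁₁ ∨ R = R₂₀) →
      ∀ i j : ℕ, 1 ≤ i → 1 ≤ j →
      |∑ k₁ ∈ Icc 1 ⌊Y⌋₊, ∑ k₂ ∈ Icc 1 ⌊Y⌋₊,
          (copTauW n k₁ * (∑ p ∈ k₁.primeFactors, Real.log p ^ 2)) * (copTauW n k₂ * (3 * (∑ p ∈ k₂.primeFactors, Real.log p ^ 2) ^ 2 - 2 * (∑ p ∈ k₂.primeFactors, Real.log p ^ 4))) * ellp Y k₁ ^ i * ellp Y k₂ ^ j * R (α * k₁ * k₂)| ≤ Real.log Y ^ (i + j) *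
          (C₀ * (K * divWeight n ^ 2 * (1 + Real.log Y) ^ 6 * (Real.sqrt (2 * α * K₁ * Y) + (1 + |Real.log (2 * α * Y ^ 2)|) ^ N / (1 + Real.log K₁) ^ A)))) ∧
      (∀ i j : ℕ, 1 ≤ i → 1 ≤ j →
      |∑ k₁ ∈ Icc 1 ⌊Y⌋₊, ∑ k₂ ∈ Icc 1 ⌊Y⌋₊,
          (copTauW n k₁ * (∑ p ∈ k₁.primeFactors, Real.log p ^ 2)) * (copTauW n k₂ * (15 * (∑ p ∈ k₂.primeFactors, Real.log p ^ 2) ^ 3 - 30 * (∑ p ∈ k₂.primeFactors, Real.log p ^ 2) * (∑ p ∈ k₂.primeFactors, Real.log p ^ 4) + 16 * (∑ p ∈ k₂.primeFactors, Real.log p ^ 6))) * ellp Y k₁ ^ i * ellp Y k₂ ^ j * R₀₀ (α * k₁ * k₂)| ≤ Real.log Y ^ (i + j) *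
          (C₀ * (K * divWeight n ^ 2 * (1 + Real.log Y) ^ 8 * (Real.sqrt (2 * α * K₁ * Y) + (1 + |Real.log (2 * α * Y ^ 2)|) ^ N / (1 + Real.log K₁) ^ A)))) ∧
      (∀ i j : ℕ, 1 ≤ i → 1 ≤ j →
      |∑ k₁ ∈ Icc 1 ⌊Y⌋₊, ∑ k₂ ∈ Icc 1 ⌊Y⌋₊,
          (copTauW n k₁ * (3 * (∑ p ∈ k₁.primeFactors, Real.log p ^ 2) ^ 2 - 2 * (∑ p ∈ k₁.primeFactors, Real.log p ^ 4))) * (copTauW n k₂ * (3 * (∑ p ∈ k₂.primeFactors, Real.log p ^ 2) ^ 2 - 2 * (∑ p ∈ k₂.primeFactors, Real.log p ^ 4))) * ellp Y k₁ ^ i * ellp Y k₂ ^ j * R₀₀ (α * k₁ * k₂)| ≤ Real.log Y ^ (i + j) *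
          (C₀ * (K * divWeight n ^ 2 * (1 + Real.log Y) ^ 6 * (Real.sqrt (2 * α * K₁ * Y) + (1 + |Real.log (2 * α * Y ^ 2)|) ^ N / (1 + Real.log K₁) ^ A)))) := by
  obtain ⟨Ca, hCa, ha⟩ := abs_sum_copTauW_le_pow A
  obtain ⟨C0, hC00, hT0⟩ := abs_sum_Wn_logDiff_pow_sub_le_pow 0 A
  obtain ⟨C2, hC20, hT2⟩ := abs_sum_Wn_logDiff_pow_sub_le_pow 2 A
  obtain ⟨C4, hC40, hT4⟩ := abs_sum_Wn_logDiff_pow_sub_le_pow 4 A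
  obtain ⟨C6, hC60, hT6⟩ := abs_sum_Wn_logDiff_pow_sub_le_pow 6 A
  obtain ⟨C8, hC80, hT8⟩ := abs_sum_Wn_logDiff_pow_sub_le_pow 8 A
  set S : ℝ := 1 + Ca + C0 + C2 + C4 + C6 + C8 with hS
  have hS1 : 1 ≤ S := by rw [hS]; linarith
  have hSS : S ≤ S ^ 2 := by nlinarith
  refine ⟨37 * S ^ 2, by positivity, fun n hn Y α K₁ hY hα hY₁ ↦ ?_⟩
  have hD1 : 1 ≤ divWeight n := one_le_divWeight hn
  have hL1 : 1 ≤ 1 + Real.log Y := by linarith [Real.log_nonneg hY]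
  have hsq : 0 ≤ Real.sqrt (2 * α * K₁ * Y) := Real.sqrt_nonneg _
  have hxN : 0 ≤ (1 + |Real.log (2 * α * Y ^ 2)|) ^ N := by positivity
  have hKA : 0 < (1 + Real.log K₁) ^ A := by
    have : 0 ≤ Real.log (K₁ : ℝ) := Real.log_natCast_nonneg K₁
    positivity
  -- the `K`-inequalities
  have hKone : ∀ Cs : ℝ, 0 ≤ Cs → Cs ≤ S → 6 * Cs + 18 * Ca ≤ 37 * S ^ 2 := by
    intro Cs h0 h1
    have : Ca ≤ S := by rw [hS]; linarith
    nlinarith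
  have hKtwo : ∀ C₁ C₂ : ℝ, 0 ≤ C₁ → 0 ≤ C₂ → C₁ ≤ S → C₂ ≤ S →
      6 * C₂ + 3 * C₁ + 10 * C₁ * C₂ ≤ 37 * S ^ 2 ∧ 18 * C₁ + 19 * C₁ * C₂ ≤ 37 * S ^ 2 := by
    intro C₁ C₂ h1 h2 h3 h4
    have h12 : C₁ * C₂ ≤ S ^ 2 := by nlinarith
    constructor <;> nlinarith
  have hC0S : C0 ≤ S := by rw [hS]; linarith
  have hC2S : C2 ≤ S := by rw [hS]; linarith
  have hC4S : C4 ≤ S := by rw [hS]; linarith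
  have hC6S : C6 ≤ S := by rw [hS]; linarith
  have hC8S : C8 ≤ S := by rw [hS]; linarith
  -- list inclusions
  have h20to25 : ∀ R : ℝ → ℝ, (R = R₀₀ ∨ R = R₀₁ ∨ R = R₀₂ ∨ R = R₀₃ ∨ R = R₀₄ ∨ R = R₁₀ ∨ R = R₁₁ ∨ R = R₁₂ ∨ R = R₁₄ ∨ R = R₂₀ ∨
      R = R₂₁ ∨ R = R₂₂ ∨ R = R₂₃ ∨ R = R₂₄ ∨ R = R₃₀ ∨ R = R₃₂ ∨ R = R₃₃ ∨ R = R₄₀ ∨ R = R₄₁ ∨ R = R₄₂) → (R = R₀₀ ∨ R = R₀₁ ∨ R = R₀₂ ∨ R = R₀₃ ∨ R = R₀₄ ∨ R = R₁₀ ∨ R = R₁₁ ∨ R = R₁₂ ∨ R = R₁₃ ∨ R = R₁₄ ∨ R = R₂₀ ∨ R = R₂₁ ∨ R = R₂₂ ∨ R = R₂₃ ∨ R = R₂₄ ∨ R = R₃₀ ∨ R = R₃₁ ∨ R = R₃₂ ∨ R = R₃₃ ∨ R = R₃₄ ∨ R = R₄₀ ∨ R = R₄₁ ∨ R = R₄₂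 ∨ R = R₄₃ ∨ R = R₄₄) := by
    intro R h
    rcases h with h|h|h|h|h|h|h|h|h|h|h|h|h|h|h|h|h|h|h|h <;> simp only [h, true_or, or_true]
  have h15to25 : ∀ R : ℝ → ℝ, (R = R₀₀ ∨ R = R₀₁ ∨ R = R₀₂ ∨ R = R₀₃ ∨ R = R₀₄ ∨ R = R₁₀ ∨ R = R₁₁ ∨ R = R₁₂ ∨ R = R₁₃ ∨ R = R₂₀ ∨ R = R₂₁ ∨ R = R₂₂ ∨ R = R₃₀ ∨ R = R₃₁ ∨ R = R₄₀) → (R = R₀₀ ∨ R = R₀₁ ∨ R = R₀₂ ∨ R = R₀₃ ∨ R = R₀₄ ∨ R = R₁₀ ∨ R = R₁₁ ∨ R = R₁₂ ∨ R = R₁₃ ∨ R = R₁₄ ∨ R = R₂₀ ∨ R = R₂₁ ∨ R = R₂₂ ∨ R = R₂₃ ∨ R = R₂₄ ∨ R = R₃₀ ∨ R = R₃₁ ∨ R = R₃₂ ∨ R = R₃₃ ∨ R = R₃₄ ∨ R = R₄₀ ∨ R = R₄₁ ∨ R = R₄₂ ∨ R = R₄₃ ∨ R = R₄₄) := by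
    intro R h
    rcases h with h|h|h|h|h|h|h|h|h|h|h|h|h|h|h <;> simp only [h, true_or, or_true]
  have h6to25 : ∀ R : ℝ → ℝ, (R = R₀₀ ∨ R = R₀₁ ∨ R = R₀₂ ∨ R = R₁₀ ∨ R = R₁₁ ∨ R = R₂₀) → (R = R₀₀ ∨ R = R₀₁ ∨ R = R₀₂ ∨ R = R₀₃ ∨ R = R₀₄ ∨ R = R₁₀ ∨ R = R₁₁ ∨ R = R₁₂ ∨ R = R₁₃ ∨ R = R₁₄ ∨ R = R₂₀ ∨ R = R₂₁ ∨ R = R₂₂ ∨ R = R₂₃ ∨ R = R₂₄ ∨ R = R₃₀ ∨ R = R₃₁ ∨ R = R₃₂ ∨ R = R₃₃ ∨ R = R₃₄ ∨ R = R₄₀ ∨ R = R₄₁ ∨ R = R₄₂ ∨ R = R₄₃ ∨ R = R₄₄) := by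
    intro R h
    rcases h with h|h|h|h|h|h <;> simp only [h, true_or, or_true]
  have h6to15 : ∀ R : ℝ → ℝ, (R = R₀₀ ∨ R = R₀₁ ∨ R = R₀₂ ∨ R = R₁₀ ∨ R = R₁₁ ∨ R = R₂₀) → (R = R₀₀ ∨ R = R₀₁ ∨ R = R₀₂ ∨ R = R₀₃ ∨ R = R₀₄ ∨ R = R₁₀ ∨ R = R₁₁ ∨ R = R₁₂ ∨ R = R₁₃ ∨ R = R₂₀ ∨ R = R₂₁ ∨ R = R₂₂ ∨ R = R₃₀ ∨ R = R₃₁ ∨ R = R₄₀) := by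
    intro R h
    rcases h with h|h|h|h|h|h <;> simp only [h, true_or, or_true]
  have h00in25 : (fun R : ℝ → ℝ ↦ R = R₀₀ ∨ R = R₀₁ ∨ R = R₀₂ ∨ R = R₀₃ ∨ R = R₀₄ ∨ R = R₁₀ ∨ R = R₁₁ ∨ R = R₁₂ ∨ R = R₁₃ ∨ R = R₁₄ ∨ R = R₂₀ ∨ R = R₂₁ ∨ R = R₂₂ ∨ R = R₂₃ ∨ R = R₂₄ ∨ R = R₃₀ ∨ R = R₃₁ ∨ R = R₃₂ ∨ R = R₃₃ ∨ R = R₃₄ ∨ R = R₄₀ ∨ R = R₄₁ ∨ R = R₄₂ ∨ R = R₄₃ ∨ R = R₄₄) R₀₀ := Or.inl rfl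
  have h00in15 : (fun R : ℝ → ℝ ↦ R = R₀₀ ∨ R = R₀₁ ∨ R = R₀₂ ∨ R = R₀₃ ∨ R = R₀₄ ∨ R = R₁₀ ∨ R = R₁₁ ∨ R = R₁₂ ∨ R = R₁₃ ∨ R = R₂₀ ∨ R = R₂₁ ∨ R = R₂₂ ∨ R = R₃₀ ∨ R = R₃₁ ∨ R = R₄₀) R₀₀ := Or.inl rfl
  -- the generic one-sided bounds
  have one := fun (s : ℕ) (Cs : ℝ) (hCs : 0 ≤ Cs) (hCsS : Cs ≤ S) hTs (R : ℝ → ℝ) (hR : R = R₀₀ ∨ R = R₀₁ ∨ R = R₀₂ ∨ R = R₀₃ ∨ R = R₀₄ ∨ R = R₁₀ ∨ R = R₁₁ ∨ R = R₁₂ ∨ R = R₁₃ ∨ R = R₁₄ ∨ R = R₂₀ ∨ R = R₂₁ ∨ R = R₂₂ ∨ R = R₂₃ ∨ R = R₂₄ ∨ R = R₃₀ ∨ R = R₃₁ ∨ R = R₃₂ ∨ R = R₃₃ ∨ R = R₃₄ ∨ R = R₄₀ ∨ R = R₄₁ ∨ R = R₄₂ ∨ R = R₄₃ ∨ R = R₄₄)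 (i j : ℕ) (hi : 1 ≤ i) (hj : 1 ≤ j) ↦
    (abs_onesided_moments_le_pow_of s A N hCa hCs ha hTs hC₀ (hall R hR) n hn Y α K₁ i j hY hα hi hj hY₁).trans
      (mul_le_mul_of_nonneg_left (onesided_env_le s hC₀ hCs hCa.le hD1 hL1 hsq hxN hKA (hKone Cs hCs hCsS))
        (pow_nonneg (Real.log_nonneg hY) _))
  have two := fun (r s e : ℕ) (hre : r + 2 ≤ e) (hse : s + 2 ≤ e) (C₁ C₂ : ℝ) (hC₁ : 0 ≤ C₁) (hC₂ : 0 ≤ C₂) (h1S : C₁ ≤ S)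
      (h2S : C₂ ≤ S) hT₁ hT₂ (R : ℝ → ℝ) (hR : R = R₀₀ ∨ R = R₀₁ ∨ R = R₀₂ ∨ R = R₀₃ ∨ R = R₀₄ ∨ R = R₁₀ ∨ R = R₁₁ ∨ R = R₁₂ ∨ R = R₁₃ ∨ R = R₂₀ ∨ R = R₂₁ ∨ R = R₂₂ ∨ R = R₃₀ ∨ R = R₃₁ ∨ R = R₄₀) (i j : ℕ) (hi : 1 ≤ i) (hj : 1 ≤ j) ↦
    (abs_bothsided_moments_le_pow_of r s A hC₁ hC₂ hT₁ hT₂ hMN hC₀ (hall R (h15to25 R hR)) (hpw R hR).1 (hpw R hR).2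
      n hn Y α K₁ i j hY hα hi hj hY₁).trans
      (mul_le_mul_of_nonneg_left (bothsided_env_le r s e hC₀ hC₁ hC₂ hD1 hL1 hsq hxN hKA hre hse
        (hKtwo C₁ C₂ hC₁ hC₂ h1S h2S).1 (hKtwo C₁ C₂ hC₁ hC₂ h1S h2S).2) (pow_nonneg (Real.log_nonneg hY) _))
  refine ⟨?_, ?_, ?_, ?_, ?_, ?_, ?_, ?_, ?_⟩
  · -- h0 : a ⊗ a, s = 0
    intro R hR i j hi hj
    have h := one 0 C0 hC00 hC0S hT0 R hR i j hi hj
    rw [Finset.sum_congr rfl fun k₁ _ ↦ Finset.sum_congr rfl fun k₂ _ ↦ by rw [copTauW_eq_mul_sum_pow_zero n k₂]]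
    simpa only [mul_assoc] using h
  · -- h2 : a ⊗ aP₂, s = 2
    intro R hR i j hi hj
    have h := one 2 C2 hC20 hC2S hT2 R (h20to25 R hR) i j hi hj
    rw [Finset.sum_congr rfl fun k₁ _ ↦ Finset.sum_congr rfl fun k₂ _ ↦ by rw [copTauW_mul_primeSq_eq n k₂]]
    exact h
  · -- h4 : a ⊗ aD₄, s = 4
    intro R hR i j hi hj
    have h := one 4 C4 hC40 hC4S hT4 R (h15to25 R hR) i j hi hj
    rw [Finset.sum_congr rfl fun k₁ _ ↦ Finset.sum_congr rfl fun k₂ _ ↦ by rw [copTauW_mul_decorFour_eq n k₂]]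
    exact h
  · -- h6 : a ⊗ a·m₆, s = 6
    intro R hR i j hi hj
    have h := one 6 C6 hC60 hC6S hT6 R (h6to25 R hR) i j hi hj
    rw [Finset.sum_congr rfl fun k₁ _ ↦ Finset.sum_congr rfl fun k₂ _ ↦ by rw [copTauW_mul_decorSix_eq n k₂]]
    exact h
  · -- h8 : a ⊗ a·m₈ against R₀₀, s = 8
    intro i j hi hj
    have h := one 8 C8 hC80 hC8S hT8 R₀₀ h00in25 i j hi hj
    rw [Finset.sum_congr rfl fun k₁ _ ↦ Finset.sum_congr rfl fun k₂ _ ↦ by rw [copTauW_mul_decorEight_eq n k₂]]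
    exact h
  · -- hB : aP₂ ⊗ aP₂, (2,2), e = 4
    intro R hR i j hi hj
    have h := two 2 2 4 (by norm_num) (by norm_num) C2 C2 hC20 hC20 hC2S hC2S hT2 hT2 R hR i j hi hj
    rw [Finset.sum_congr rfl fun k₁ _ ↦ Finset.sum_congr rfl fun k₂ _ ↦ by
      rw [copTauW_mul_primeSq_eq n k₁, copTauW_mul_primeSq_eq n k₂]]
    exact h
  · -- hBD : aP₂ ⊗ aD₄, (2,4), e = 6
    intro R hR i j hi hj
    have h := two 2 4 6 (by norm_num) (by norm_num) C2 C4 hC20 hC40 hC2S hC4S hT2 hT4 R (h6to15 R hR) i j hi hj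
    rw [Finset.sum_congr rfl fun k₁ _ ↦ Finset.sum_congr rfl fun k₂ _ ↦ by
      rw [copTauW_mul_primeSq_eq n k₁, copTauW_mul_decorFour_eq n k₂]]
    exact h
  · -- hBS : aP₂ ⊗ a·m₆ against R₀₀, (2,6), e = 8
    intro i j hi hj
    have h := two 2 6 8 (by norm_num) (by norm_num) C2 C6 hC20 hC60 hC2S hC6S hT2 hT6 R₀₀ h00in15 i j hi hj
    rw [Finset.sum_congr rfl fun k₁ _ ↦ Finset.sum_congr rfl fun k₂ _ ↦ by
      rw [copTauW_mul_primeSq_eq n k₁, copTauW_mul_decorSix_eq n k₂]]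
    exact h
  · -- hDD : aD₄ ⊗ aD₄ against R₀₀, (4,4), e = 6
    intro i j hi hj
    have h := two 4 4 6 (by norm_num) (by norm_num) C4 C4 hC40 hC40 hC4S hC4S hT4 hT4 R₀₀ h00in15 i j hi hj
    rw [Finset.sum_congr rfl fun k₁ _ ↦ Finset.sum_congr rfl fun k₂ _ ↦ by
      rw [copTauW_mul_decorFour_eq n k₁, copTauW_mul_decorFour_eq n k₂]]
    exact h

end Summit.Parity.GeneralizedHardyLittlewood.Theorems.MomentsBeyondDiagonal.DiagCorner

end
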